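import Literature.AlgebraicGeometry.Resolution.LogRegularResolution
import Literature.AlgebraicGeometry.Resolution.BlowupChartTransition
import HarnessLib

/-!
# The charts of a log blow-up as log charts: the monoids `P⟨−a⟩ ⊇ P_a` and the chart `Φ_a`

Topic: `Literature/AlgebraicGeometry/Resolution`. For an affine log scheme given by ONE chart
`φ : P → (A, ·)`, `P ⊆ ℤⁿ` (`LogRegularResolution.lean`), and a monoid ideal generated by a set
`s ⊆ P`, the log blow-up along `s` (K. Kato, *Toric singularities*, Amer. J. Math. 116 (1994),
(9.9)–(10.3): `(X, M) ×_{F(X)} F'`; W. Nizioł, *Toric singularities: log-blow-ups and global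
resolutions*, J. Algebraic Geom. 15 (2006), §4) is covered, for `a ∈ s`, by the charts with monoid
"`P_a` … a submonoid of `Pᵍᵖ` generated by `P` and elements of the form `b a⁻¹`, `b ∈ J₀`"
(Nizioł, proof of Prop. 4.2), mapping to the affine blowup algebra `A[I/φ(a)] ⊆ A[1/φ(a)]`,
`I = (φ(s))` — and for `(X, M)` log regular the log blow-up IS the blowing up of `Spec A` along
`I` (Nizioł Prop. 4.3). This file DEFINES these chart data over the tree's `blowupAlgebra`
(`AffineBlowupAlgebra.lean`) and PROVES their basic properties; no log regularity is assumed: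

* `LogChart.awayMonoid P a = P⟨−a⟩ := {v ∈ ℤⁿ : v + k·a ∈ P for some k}` (the localisation of
  the monoid `P` at `a`, inside `ℤⁿ`), `LogChart.blowupChartMonoid P s a = P_a := ⟨P ∪ (s − a)⟩`,
  with `P ≤ P_a ≤ P⟨−a⟩`;
* `LogChart.awayChart P φ a : P⟨−a⟩ → A[1/φ(a)]`, `v ↦ φ(v + k a)·φ(a)⁻ᵏ` — a monoid homomorphism,
  independent of `k` (`awayChart_eq`), extending `φ` (`awayChart_of_mem`) with
  `Φ_a(g − a)·φ(a) = φ(g)` (`awayChart_sub_mul_algebraMap`) and `Φ_a(−a)·φ(a) = 1`;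
* `LogChart.awayChart_mem_blowupAlgebra` — `Φ_a(P_a) ⊆ A[I/φ(a)]` for `I = (φ(s))`; hence the
  monoid homomorphism **`LogChart.blowupChart P φ s a : P_a → A[I/φ(a)]`**, the log chart of the
  blow-up chart `D₊(φ(a) t) = Spec A[I/φ(a)]`, and `LogChart.blowupAlgebra_eq_adjoin_awayChart`,
  `LogChart.adjoin_range_blowupChart_eq_top` — `A[I/φ(a)]` is generated over `A` by the chart
  elements `Φ_a(g − a)`, `g ∈ s`.

## Use

With `LogRegularBlowupCriterion.lean` (`Kato1994_logRegular_hasResolution_of_charts`): Kato's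
resolution of `Spec A` for a log regular chart `φ` is reduced to the regularity of the local rings
of the `A[I/φ(a)]`, `a ∈ s`, for a subdividing monoid ideal `(s)`; by Kato (10.3)/(10.4) this is
obtained from the log regularity of the charts `(Spec A[I/φ(a)], P_a)` defined here together with
the freeness of the sharp quotients of `P_a`. Neither of these two inputs is proved in this file.

## Sources

* [Niziol2006] W. Nizioł, *Toric singularities: log-blow-ups and global resolutions*,
  J. Algebraic Geom. 15 (2006) 1–29: §4, proof of Prop. 4.2 ("`P_a` is a submonoid of `Pᵍᵖ`
  generated by `P` and elements of the form `b a⁻¹`, `b ∈ J₀`"; the chart maps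
  `ℤ[P_a] → ℤ[Q] ⊗ …`), Prop. 4.3 (for `(X, M_X)` log regular the log blow-up at `J` is the
  blow-up of the ideal `J𝒪_X`) (text read, pp. 11–13).
* [Kato1994] K. Kato, *Toric singularities*, Amer. J. Math. 116 (1994): (9.9)–(9.10)
  (`(X, M) ×_F F'`), (10.3)–(10.4) (text read, p. 1092).
* [GortzWedhorn2020] U. Görtz, T. Wedhorn, *Algebraic Geometry I*, 2nd ed., (13.19) p. 415
  (`A[I/f] ⊆ A_f` generated by the `x/f`).
-/

noncomputable section

open IsLocalization

namespace Literature.AlgebraicGeometry.Resolution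

namespace LogChart

universe u

variable {n : ℕ} {A : Type u} [CommRing A] (P : AddSubmonoid (Fin n → ℤ))
  (φ : Multiplicative P →* A)

/-! ## The monoids `P⟨−a⟩` and `P_a` -/

/-- **The localisation `P⟨−a⟩` of `P` at `a ∈ P`, inside `ℤⁿ`**: the vectors `v` with
`v + k·a ∈ P` for some `k ∈ ℕ` (i.e. `P − ℕa ⊆ Pᵍᵖ ⊆ ℤⁿ`; the monoid of the open
`Spec ℤ[P]_{a} ⊆ Spec ℤ[P]`). [cite: Niziol2006, §4 (proof of Prop. 4.2)] -/
def awayMonoid (a : P) : AddSubmonoid (Fin n → ℤ) where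
  carrier := {v | ∃ k : ℕ, v + k • (a : Fin n → ℤ) ∈ P}
  zero_mem' := ⟨0, by simp⟩
  add_mem' := by
    rintro v w ⟨k, hk⟩ ⟨l, hl⟩
    refine ⟨k + l, ?_⟩
    have : v + w + (k + l) • (a : Fin n → ℤ) =
        (v + k • (a : Fin n → ℤ)) + (w + l • (a : Fin n → ℤ)) := by
      rw [add_smul]; abel
    rw [this]
    exact P.add_mem hk hl

/-- Membership in `P⟨−a⟩` (`Iff.rfl`). [cite: Niziol2006, §4 (proof of Prop. 4.2)] -/
theorem mem_awayMonoid_iff {a : P} {v : Fin n → ℤ} :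
    v ∈ awayMonoid P a ↔ ∃ k : ℕ, v + k • (a : Fin n → ℤ) ∈ P :=
  Iff.rfl

/-- `P ⊆ P⟨−a⟩`. [cite: Niziol2006, §4 (proof of Prop. 4.2)] -/
theorem le_awayMonoid (a : P) : P ≤ awayMonoid P a :=
  fun v hv => ⟨0, by simpa using hv⟩

/-- `g − a ∈ P⟨−a⟩` for `g ∈ P`. [cite: Niziol2006, §4 (proof of Prop. 4.2)] -/
theorem sub_mem_awayMonoid (a : P) {g : Fin n → ℤ} (hg : g ∈ P) :
    g - (a : Fin n → ℤ) ∈ awayMonoid P a :=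
  ⟨1, by simpa using hg⟩

/-- `−a ∈ P⟨−a⟩`: `a` becomes invertible. [cite: Niziol2006, §4 (proof of Prop. 4.2)] -/
theorem neg_mem_awayMonoid (a : P) : -(a : Fin n → ℤ) ∈ awayMonoid P a :=
  ⟨1, by simp⟩

/-- **The chart monoid `P_a` of the log blow-up along the monoid ideal generated by `s ⊆ P`, at
`a`**: "a submonoid of `Pᵍᵖ` generated by `P` and elements of the form `b a⁻¹`, `b ∈ J₀`"
(additively: by `P` and the `g − a`, `g ∈ s`). [cite: Niziol2006, §4 (proof of Prop. 4.2)] -/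
def blowupChartMonoid (s : Set P) (a : P) : AddSubmonoid (Fin n → ℤ) :=
  AddSubmonoid.closure ((P : Set (Fin n → ℤ)) ∪ (fun g : P => (g : Fin n → ℤ) - a) '' s)

/-- `P ⊆ P_a`. [cite: Niziol2006, §4 (proof of Prop. 4.2)] -/
theorem le_blowupChartMonoid (s : Set P) (a : P) : P ≤ blowupChartMonoid P s a :=
  fun _ hv => AddSubmonoid.subset_closure (Or.inl hv)

/-- `g − a ∈ P_a` for `g ∈ s`. [cite: Niziol2006, §4 (proof of Prop. 4.2)] -/
theorem sub_mem_blowupChartMonoid {s : Set P} (a : P) {g : P} (hg : g ∈ s) :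
    (g : Fin n → ℤ) - a ∈ blowupChartMonoid P s a :=
  AddSubmonoid.subset_closure (Or.inr ⟨g, hg, rfl⟩)

/-- `P_a ⊆ P⟨−a⟩`. [cite: Niziol2006, §4 (proof of Prop. 4.2)] -/
theorem blowupChartMonoid_le_awayMonoid (s : Set P) (a : P) :
    blowupChartMonoid P s a ≤ awayMonoid P a := by
  refine AddSubmonoid.closure_le.2 (Set.union_subset (le_awayMonoid P a) ?_)
  rintro _ ⟨g, -, rfl⟩
  exact sub_mem_awayMonoid P a g.2

/-! ## The chart `Φ_a : P⟨−a⟩ → A[1/φ(a)]` -/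

/-- `φ(p + k·a) = φ(p)·φ(a)ᵏ`. [folklore] -/
private theorem map_add_nsmul (a p : P) (k : ℕ) :
    φ (Multiplicative.ofAdd (p + k • a)) =
      φ (Multiplicative.ofAdd p) * φ (Multiplicative.ofAdd a) ^ k := by
  rw [ofAdd_add, map_mul, ofAdd_nsmul, map_pow]

/-- `φ(a)⁻ᵏ·φ(a)ᵏ = 1` in `A[1/φ(a)]`. [folklore] -/
private theorem invSelf_pow_mul_algebraMap_pow (a : P) (k : ℕ) :
    Away.invSelf (φ (Multiplicative.ofAdd a)) ^ k *
      algebraMap A (Localization.Away (φ (Multiplicative.ofAdd a)))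
        (φ (Multiplicative.ofAdd a)) ^ k = 1 := by
  rw [← mul_pow, mul_comm, Away.mul_invSelf, one_pow]

open Classical in
/-- The underlying function of the chart `Φ_a`: `v ↦ φ(v + k·a)·φ(a)⁻ᵏ` for SOME `k` with
`v + k·a ∈ P` (chosen; the value does not depend on the choice, `awayFun_eq`).
[cite: Niziol2006, §4 (proof of Prop. 4.2)] -/
def awayFun (a : P) (v : awayMonoid P a) : Localization.Away (φ (Multiplicative.ofAdd a)) :=
  algebraMap A (Localization.Away (φ (Multiplicative.ofAdd a)))
      (φ (Multiplicative.ofAdd ⟨(v : Fin n → ℤ) + (Classical.choose v.2) • (a : Fin n → ℤ),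
        Classical.choose_spec v.2⟩)) *
    Away.invSelf (φ (Multiplicative.ofAdd a)) ^ Classical.choose v.2

/-- **Well-definedness of `Φ_a`**: `Φ_a(v) = φ(v + k·a)·φ(a)⁻ᵏ` for EVERY `k` with `v + k·a ∈ P`
(cross-multiply: `(v + k₀a) + k a = (v + k a) + k₀ a` in `P`, and `φ(a)` is a unit of
`A[1/φ(a)]`). [cite: Niziol2006, §4 (proof of Prop. 4.2)] -/
theorem awayFun_eq (a : P) (v : awayMonoid P a) (k : ℕ)
    (hk : (v : Fin n → ℤ) + k • (a : Fin n → ℤ) ∈ P) :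
    awayFun P φ a v = algebraMap A (Localization.Away (φ (Multiplicative.ofAdd a)))
        (φ (Multiplicative.ofAdd ⟨(v : Fin n → ℤ) + k • (a : Fin n → ℤ), hk⟩)) *
      Away.invSelf (φ (Multiplicative.ofAdd a)) ^ k := by
  classical
  set L := Localization.Away (φ (Multiplicative.ofAdd a))
  have hk₀ : (v : Fin n → ℤ) + (Classical.choose v.2) • (a : Fin n → ℤ) ∈ P :=
    Classical.choose_spec v.2
  set k₀ := Classical.choose v.2 with hk₀def
  -- the two numerators agree after adding the other multiple of `a`
  have key : (⟨(v : Fin n → ℤ) + k₀ • (a : Fin n → ℤ), hk₀⟩ : P) + k • a =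
      (⟨(v : Fin n → ℤ) + k • (a : Fin n → ℤ), hk⟩ : P) + k₀ • a := by
    apply Subtype.ext
    simp only [AddSubmonoid.coe_add, AddSubmonoidClass.coe_nsmul]
    abel
  have hu : IsUnit (algebraMap A L (φ (Multiplicative.ofAdd a)) ^ (k₀ + k)) :=
    (IsLocalization.Away.algebraMap_isUnit (φ (Multiplicative.ofAdd a))).pow _
  refine (hu.mul_left_inj).1 ?_
  change algebraMap A L (φ (Multiplicative.ofAdd ⟨(v : Fin n → ℤ) + k₀ • (a : Fin n → ℤ), hk₀⟩)) *
      Away.invSelf (φ (Multiplicative.ofAdd a)) ^ k₀ *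
      algebraMap A L (φ (Multiplicative.ofAdd a)) ^ (k₀ + k) = _
  calc algebraMap A L (φ (Multiplicative.ofAdd ⟨(v : Fin n → ℤ) + k₀ • (a : Fin n → ℤ), hk₀⟩)) *
        Away.invSelf (φ (Multiplicative.ofAdd a)) ^ k₀ *
        algebraMap A L (φ (Multiplicative.ofAdd a)) ^ (k₀ + k)
      = algebraMap A L (φ (Multiplicative.ofAdd ⟨(v : Fin n → ℤ) + k₀ • (a : Fin n → ℤ), hk₀⟩)) *
          algebraMap A L (φ (Multiplicative.ofAdd a)) ^ k *
          (Away.invSelf (φ (Multiplicative.ofAdd a)) ^ k₀ *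
            algebraMap A L (φ (Multiplicative.ofAdd a)) ^ k₀) := by rw [pow_add]; ring
    _ = algebraMap A L (φ (Multiplicative.ofAdd
          ((⟨(v : Fin n → ℤ) + k₀ • (a : Fin n → ℤ), hk₀⟩ : P) + k • a))) := by
          rw [invSelf_pow_mul_algebraMap_pow, mul_one, map_add_nsmul, map_mul, map_pow]
    _ = algebraMap A L (φ (Multiplicative.ofAdd
          ((⟨(v : Fin n → ℤ) + k • (a : Fin n → ℤ), hk⟩ : P) + k₀ • a))) := by rw [key]
    _ = algebraMap A L (φ (Multiplicative.ofAdd ⟨(v : Fin n → ℤ) + k • (a : Fin n → ℤ), hk⟩)) *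
          algebraMap A L (φ (Multiplicative.ofAdd a)) ^ k₀ *
          (Away.invSelf (φ (Multiplicative.ofAdd a)) ^ k *
            algebraMap A L (φ (Multiplicative.ofAdd a)) ^ k) := by
          rw [invSelf_pow_mul_algebraMap_pow, mul_one, map_add_nsmul, map_mul, map_pow]
    _ = algebraMap A L (φ (Multiplicative.ofAdd ⟨(v : Fin n → ℤ) + k • (a : Fin n → ℤ), hk⟩)) *
          Away.invSelf (φ (Multiplicative.ofAdd a)) ^ k *
          algebraMap A L (φ (Multiplicative.ofAdd a)) ^ (k₀ + k) := by rw [pow_add]; ring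

/-- **The chart `Φ_a : P⟨−a⟩ → (A[1/φ(a)], ·)`** of the localised monoid, `v ↦ φ(v + k·a)/φ(a)ᵏ`,
as a monoid homomorphism (multiplicativity: add the exponents and use `awayFun_eq`).
[cite: Niziol2006, §4 (proof of Prop. 4.2)] -/
def awayChart (a : P) :
    Multiplicative (awayMonoid P a) →* Localization.Away (φ (Multiplicative.ofAdd a)) where
  toFun v := awayFun P φ a (Multiplicative.toAdd v)
  map_one' := by
    change awayFun P φ a 0 = 1
    have h0 : ((0 : awayMonoid P a) : Fin n → ℤ) + (0 : ℕ) • (a : Fin n → ℤ) ∈ P := by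
      simp
    rw [awayFun_eq P φ a 0 0 h0, pow_zero, mul_one]
    have : (⟨((0 : awayMonoid P a) : Fin n → ℤ) + (0 : ℕ) • (a : Fin n → ℤ), h0⟩ : P) = 0 :=
      Subtype.ext (by simp)
    rw [this, ofAdd_zero, map_one, map_one]
  map_mul' v w := by
    change awayFun P φ a (Multiplicative.toAdd v + Multiplicative.toAdd w) =
      awayFun P φ a (Multiplicative.toAdd v) * awayFun P φ a (Multiplicative.toAdd w)
    obtain ⟨k, hk⟩ := (Multiplicative.toAdd v).2
    obtain ⟨l, hl⟩ := (Multiplicative.toAdd w).2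
    have hkl : ((Multiplicative.toAdd v + Multiplicative.toAdd w : awayMonoid P a) : Fin n → ℤ) +
        (k + l) • (a : Fin n → ℤ) ∈ P := by
      have : ((Multiplicative.toAdd v + Multiplicative.toAdd w : awayMonoid P a) : Fin n → ℤ) +
          (k + l) • (a : Fin n → ℤ) =
          ((Multiplicative.toAdd v : awayMonoid P a) + k • (a : Fin n → ℤ)) +
            ((Multiplicative.toAdd w : awayMonoid P a) + l • (a : Fin n → ℤ)) := by
        rw [AddSubmonoid.coe_add, add_smul]; abel
      rw [this]; exact P.add_mem hk hl
    rw [awayFun_eq P φ a _ (k + l) hkl, awayFun_eq P φ a _ k hk, awayFun_eq P φ a _ l hl]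
    have hsum : (⟨((Multiplicative.toAdd v + Multiplicative.toAdd w : awayMonoid P a) :
          Fin n → ℤ) + (k + l) • (a : Fin n → ℤ), hkl⟩ : P) =
        (⟨((Multiplicative.toAdd v : awayMonoid P a) : Fin n → ℤ) + k • (a : Fin n → ℤ), hk⟩ : P) +
          ⟨((Multiplicative.toAdd w : awayMonoid P a) : Fin n → ℤ) + l • (a : Fin n → ℤ), hl⟩ := by
      apply Subtype.ext
      simp only [AddSubmonoid.coe_add, add_smul]
      abel
    rw [hsum, ofAdd_add, map_mul, map_mul, pow_add]
    ring

/-- `Φ_a` on the underlying function. [cite: Niziol2006, §4 (proof of Prop. 4.2)] -/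
theorem awayChart_apply (a : P) (v : awayMonoid P a) :
    awayChart P φ a (Multiplicative.ofAdd v) = awayFun P φ a v :=
  rfl

/-- **`Φ_a(v) = φ(v + k·a)·φ(a)⁻ᵏ`** for every admissible `k`.
[cite: Niziol2006, §4 (proof of Prop. 4.2)] -/
theorem awayChart_eq (a : P) (v : awayMonoid P a) (k : ℕ)
    (hk : (v : Fin n → ℤ) + k • (a : Fin n → ℤ) ∈ P) :
    awayChart P φ a (Multiplicative.ofAdd v) =
      algebraMap A (Localization.Away (φ (Multiplicative.ofAdd a)))
        (φ (Multiplicative.ofAdd ⟨(v : Fin n → ℤ) + k • (a : Fin n → ℤ), hk⟩)) *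
      Away.invSelf (φ (Multiplicative.ofAdd a)) ^ k :=
  awayFun_eq P φ a v k hk

/-- **`Φ_a` extends `φ`**: on `P ⊆ P⟨−a⟩`, `Φ_a(p) = φ(p)/1`.
[cite: Niziol2006, §4 (proof of Prop. 4.2)] -/
theorem awayChart_of_mem (a : P) (p : P) :
    awayChart P φ a (Multiplicative.ofAdd ⟨(p : Fin n → ℤ), le_awayMonoid P a p.2⟩) =
      algebraMap A (Localization.Away (φ (Multiplicative.ofAdd a))) (φ (Multiplicative.ofAdd p)) := by
  have h0 : ((⟨(p : Fin n → ℤ), le_awayMonoid P a p.2⟩ : awayMonoid P a) : Fin n → ℤ) +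
      (0 : ℕ) • (a : Fin n → ℤ) ∈ P := by simp
  rw [awayChart_eq P φ a _ 0 h0, pow_zero, mul_one]
  have : (⟨((⟨(p : Fin n → ℤ), le_awayMonoid P a p.2⟩ : awayMonoid P a) : Fin n → ℤ) +
      (0 : ℕ) • (a : Fin n → ℤ), h0⟩ : P) = p := Subtype.ext (by simp)
  rw [this]

/-- **`Φ_a(g − a) = φ(g)·φ(a)⁻¹`** for `g ∈ P`. [cite: Niziol2006, §4 (proof of Prop. 4.2)] -/
theorem awayChart_sub (a : P) (g : P) :
    awayChart P φ a (Multiplicative.ofAdd ⟨(g : Fin n → ℤ) - a, sub_mem_awayMonoid P a g.2⟩) =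
      algebraMap A (Localization.Away (φ (Multiplicative.ofAdd a))) (φ (Multiplicative.ofAdd g)) *
        Away.invSelf (φ (Multiplicative.ofAdd a)) := by
  have h1 : ((⟨(g : Fin n → ℤ) - a, sub_mem_awayMonoid P a g.2⟩ : awayMonoid P a) :
      Fin n → ℤ) + (1 : ℕ) • (a : Fin n → ℤ) ∈ P := by simp
  rw [awayChart_eq P φ a _ 1 h1, pow_one]
  have : (⟨((⟨(g : Fin n → ℤ) - a, sub_mem_awayMonoid P a g.2⟩ : awayMonoid P a) :
      Fin n → ℤ) + (1 : ℕ) • (a : Fin n → ℤ), h1⟩ : P) = g := Subtype.ext (by simp)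
  rw [this]

/-- `Φ_a(g − a)·φ(a) = φ(g)` in `A[1/φ(a)]`. [cite: Niziol2006, §4 (proof of Prop. 4.2)] -/
theorem awayChart_sub_mul_algebraMap (a : P) (g : P) :
    awayChart P φ a (Multiplicative.ofAdd ⟨(g : Fin n → ℤ) - a, sub_mem_awayMonoid P a g.2⟩) *
        algebraMap A (Localization.Away (φ (Multiplicative.ofAdd a))) (φ (Multiplicative.ofAdd a)) =
      algebraMap A (Localization.Away (φ (Multiplicative.ofAdd a))) (φ (Multiplicative.ofAdd g)) := by
  rw [awayChart_sub, mul_assoc, mul_comm (Away.invSelf _), Away.mul_invSelf, mul_one]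

/-- `Φ_a(−a)·φ(a) = 1`: `φ(a)` is inverted. [cite: Niziol2006, §4 (proof of Prop. 4.2)] -/
theorem awayChart_neg_mul_algebraMap (a : P) :
    awayChart P φ a (Multiplicative.ofAdd ⟨-(a : Fin n → ℤ), neg_mem_awayMonoid P a⟩) *
        algebraMap A (Localization.Away (φ (Multiplicative.ofAdd a))) (φ (Multiplicative.ofAdd a)) =
      1 := by
  have h1 : ((⟨-(a : Fin n → ℤ), neg_mem_awayMonoid P a⟩ : awayMonoid P a) : Fin n → ℤ) +
      (1 : ℕ) • (a : Fin n → ℤ) ∈ P := by simp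
  rw [awayChart_eq P φ a _ 1 h1, pow_one]
  have : (⟨((⟨-(a : Fin n → ℤ), neg_mem_awayMonoid P a⟩ : awayMonoid P a) : Fin n → ℤ) +
      (1 : ℕ) • (a : Fin n → ℤ), h1⟩ : P) = 0 := Subtype.ext (by simp)
  rw [this, ofAdd_zero, map_one, map_one, one_mul, mul_comm, Away.mul_invSelf]

/-! ## The chart `P_a → A[I/φ(a)]` of the blow-up chart -/

/-- **`Φ_a(P_a) ⊆ A[I/φ(a)]`** for `I = (φ(s))`: the generators `p ∈ P` go to `φ(p)/1 ∈ A`, the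
`g − a`, `g ∈ s`, to `φ(g)/φ(a) ∈ A[I/φ(a)]`, and `A[I/φ(a)]` is multiplicatively closed.
[cite: Niziol2006, §4 (proof of Prop. 4.2) and Prop. 4.3] -/
theorem awayChart_mem_blowupAlgebra (s : Set P) (a : P) {v : Fin n → ℤ}
    (hv : v ∈ blowupChartMonoid P s a) :
    awayChart P φ a (Multiplicative.ofAdd ⟨v, blowupChartMonoid_le_awayMonoid P s a hv⟩) ∈
      blowupAlgebra (Ideal.span ((fun p : P => φ (Multiplicative.ofAdd p)) '' s))
        (φ (Multiplicative.ofAdd a)) := by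
  induction hv using AddSubmonoid.closure_induction with
  | mem x hx =>
    rcases hx with hx | ⟨g, hg, rfl⟩
    · have := awayChart_of_mem P φ a ⟨x, hx⟩
      rw [show (⟨x, blowupChartMonoid_le_awayMonoid P s a (AddSubmonoid.subset_closure
          (Or.inl hx))⟩ : awayMonoid P a) = ⟨x, le_awayMonoid P a hx⟩ from rfl, this]
      exact Subalgebra.algebraMap_mem _ _
    · rw [show (⟨(g : Fin n → ℤ) - a, blowupChartMonoid_le_awayMonoid P s a
          (AddSubmonoid.subset_closure (Or.inr ⟨g, hg, rfl⟩))⟩ : awayMonoid P a) =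
          ⟨(g : Fin n → ℤ) - a, sub_mem_awayMonoid P a g.2⟩ from rfl, awayChart_sub]
      exact div_mem_blowupAlgebra _ _ (Ideal.subset_span ⟨g, hg, rfl⟩)
  | zero =>
    rw [show (⟨0, blowupChartMonoid_le_awayMonoid P s a (AddSubmonoid.zero_mem _)⟩ :
        awayMonoid P a) = 0 from rfl, ofAdd_zero, map_one]
    exact Subalgebra.one_mem _
  | add x y hx hy ihx ihy =>
    rw [show (⟨x + y, blowupChartMonoid_le_awayMonoid P s a (AddSubmonoid.add_mem _ hx hy)⟩ :
        awayMonoid P a) = ⟨x, blowupChartMonoid_le_awayMonoid P s a hx⟩ +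
          ⟨y, blowupChartMonoid_le_awayMonoid P s a hy⟩ from rfl, ofAdd_add, map_mul]
    exact Subalgebra.mul_mem _ ihx ihy

/-- **The log chart of the blow-up chart**: `Φ_a` restricted to `P_a`, with values in the
affine blowup algebra `A[I/φ(a)]`, `I = (φ(s))` (the chart `P_a → ℤ[P_a] ⊗_{ℤ[P]} 𝒪_X` of the
log blow-up, Nizioł §4, composed with the surjection onto the blow-up chart, which is an
isomorphism for `(X, M)` log regular, Prop. 4.3).
[cite: Niziol2006, §4 (proof of Prop. 4.2) and Prop. 4.3] -/
def blowupChart (s : Set P) (a : P) :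
    Multiplicative (blowupChartMonoid P s a) →*
      blowupAlgebra (Ideal.span ((fun p : P => φ (Multiplicative.ofAdd p)) '' s))
        (φ (Multiplicative.ofAdd a)) :=
  MonoidHom.codRestrict
    ((awayChart P φ a).comp
      (AddSubmonoid.inclusion (blowupChartMonoid_le_awayMonoid P s a)).toMultiplicative)
    _ fun v => awayChart_mem_blowupAlgebra P φ s a (Multiplicative.toAdd v).2

/-- `blowupChart` is `Φ_a` (on values in `A[1/φ(a)]`). [cite: Niziol2006, §4 (proof of Prop. 4.2)] -/
@[simp] theorem coe_blowupChart (s : Set P) (a : P) (v : blowupChartMonoid P s a) :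
    (blowupChart P φ s a (Multiplicative.ofAdd v) : Localization.Away (φ (Multiplicative.ofAdd a))) =
      awayChart P φ a (Multiplicative.ofAdd
        ⟨(v : Fin n → ℤ), blowupChartMonoid_le_awayMonoid P s a v.2⟩) :=
  rfl

/-- On `P ⊆ P_a` the blow-up chart is `φ` followed by `A → A[I/φ(a)]`.
[cite: Niziol2006, §4 (proof of Prop. 4.2)] -/
theorem blowupChart_of_mem (s : Set P) (a : P) (p : P) :
    blowupChart P φ s a (Multiplicative.ofAdd ⟨(p : Fin n → ℤ), le_blowupChartMonoid P s a p.2⟩) =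
      algebraMap A _ (φ (Multiplicative.ofAdd p)) := by
  apply Subtype.ext
  rw [coe_blowupChart]
  exact awayChart_of_mem P φ a p

/-- The chart element of `g − a`, `g ∈ s`, times `φ(a)` is `φ(g)` in `A[I/φ(a)]`.
[cite: Niziol2006, §4 (proof of Prop. 4.2)] -/
theorem blowupChart_sub_mul_algebraMap {s : Set P} (a : P) {g : P} (hg : g ∈ s) :
    blowupChart P φ s a (Multiplicative.ofAdd
        ⟨(g : Fin n → ℤ) - a, sub_mem_blowupChartMonoid P a hg⟩) *
        algebraMap A _ (φ (Multiplicative.ofAdd a)) =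
      algebraMap A _ (φ (Multiplicative.ofAdd g)) := by
  apply Subtype.ext
  rw [Subalgebra.coe_mul, coe_blowupChart]
  exact awayChart_sub_mul_algebraMap P φ a g

/-- **`A[I/φ(a)]` is generated over `A` by the chart elements `Φ_a(g − a) = φ(g)/φ(a)`, `g ∈ s`**
(`I = (φ(s))`; Görtz–Wedhorn (13.19): `A[I/f]` is generated by the `x/f`, `x` running through
generators of `I` — `blowupAlgebra_eq_adjoin_of_span_eq`).
[cite: GortzWedhorn2020, (13.19) p. 415] [cite: Niziol2006, Prop. 4.3] -/
theorem blowupAlgebra_eq_adjoin_awayChart (s : Set P) (a : P) :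
    blowupAlgebra (Ideal.span ((fun p : P => φ (Multiplicative.ofAdd p)) '' s))
        (φ (Multiplicative.ofAdd a)) =
      Algebra.adjoin A ((fun g : P => awayChart P φ a
        (Multiplicative.ofAdd ⟨(g : Fin n → ℤ) - a, sub_mem_awayMonoid P a g.2⟩)) '' s) := by
  rw [blowupAlgebra_eq_adjoin_of_span_eq _ _ rfl, Set.image_image]
  congr 1
  refine Set.image_congr fun g _ => ?_
  rw [awayChart_sub]

/-- Hence **the range of the blow-up chart generates `A[I/φ(a)]` as an `A`-algebra** (indeed the
chart elements of the `g − a`, `g ∈ s`, suffice). [cite: Niziol2006, Prop. 4.3] -/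
theorem adjoin_range_blowupChart_eq_top (s : Set P) (a : P) :
    Algebra.adjoin A (Set.range (blowupChart P φ s a)) = ⊤ := by
  apply Subalgebra.map_injective (f := (blowupAlgebra (Ideal.span
      ((fun p : P => φ (Multiplicative.ofAdd p)) '' s)) (φ (Multiplicative.ofAdd a))).val)
    Subtype.val_injective
  rw [Algebra.map_top, Subalgebra.range_val, AlgHom.map_adjoin]
  apply le_antisymm
  · refine Algebra.adjoin_le ?_
    rintro _ ⟨_, ⟨v, rfl⟩, rfl⟩
    exact (blowupChart P φ s a v).2
  · refine (blowupAlgebra_eq_adjoin_awayChart P φ s a).le.trans (Algebra.adjoin_mono ?_)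
    rintro _ ⟨g, hg, rfl⟩
    exact ⟨_, ⟨Multiplicative.ofAdd ⟨(g : Fin n → ℤ) - a, sub_mem_blowupChartMonoid P a hg⟩, rfl⟩,
      rfl⟩

end LogChart

end Literature.AlgebraicGeometry.Resolution

end
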